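import Mathlib
import HarnessLib
import Summits.NavierStokesRegularity.NavierStokesRegularity.Theorems.UnthreadedRigidityDoorUnthreadedRigiditySpectralEdgeSharpCoercivity

/-!
# Route `UnthreadedRigidityDoor`, wall item W2 `UnthreadedRigidity` (stmt-NavierStokesRegularity-27585) — LINE g13-2 «EDGE COERCIVITY»
# (ns-idea-6 g13, `EdgeCoercive_sketch.lean` v1.4 §1): ★ O-INT — the PAIRING IDENTITY `EdgeIntegralIdentity l`, every degree, VERBATIM
# (sketch-local `edgeForm` / `hessSq` / `gradSq` / `lapSW` / `coerciveFunctional` unfolded)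

Seat ns-es-p1 g9.  `∫_{S²} 48𝔅_l[Y]·Φ dσ = S(σ) := ∫_{S²} ({Y, Δ_S W}·Φ + 6λΦ²) dσ`, `Φ = {Y,|∇Y|²}`, `λ = l(l+1)`, where the sketch's ambient
representative of `Δ_S W` is `lapSW l Y = Δ₃|∇Y|² − (2l−2)(2l−1)|∇Y|² − l²(Δ₃(Y²) − 2l(2l+1)Y²)`.  In fact the two INTEGRANDS agree at every point of
`ℝ³`: by Bochner `Δ₃|∇Y|² = 2|∇²Y|²` (`lap3_gradSq`), `Δ₃(Y²) = 2|∇Y|²` (`lap3_sq`), `{Y,Y²} = 0` (`pbr_self_sq`) and (I9) `{Y,|∇²Y|²} = ¼Δ₃Φ`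
(`bracketLaplacian`): `{Y, lapSW} = ½Δ₃Φ − (6l²−6l+2)Φ`, so `{Y,lapSW}Φ + 6l(l+1)Φ² = ½ΦΔ₃Φ + (12l−2)Φ² = 48𝔅_l[Y]·Φ` (`edgeHalfLaplacian`).

HONEST LABEL: identifies the line's typed functional `coerciveFunctional` with the edge pairing (O-INT); with `edgeSharpCoercivity` it gives
`S(σ) ≥ (12l−2)‖Φ‖²` — the sketch's `EdgeInequality l` (strict positivity when `Φ ≢ 0` on `S²`) additionally needs positivity of the sphere measure on
open sets, NOT done here.  Rung-line support two levels below W2; nothing here bears on `UnthreadedRigidity` (27585), W2 or NS regularity.  0 kit.  [folklore]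
-/

noncomputable section

-- the summit and its single sub-problem share the name (CONVENTIONS §1), as in every Theorems file
set_option linter.dupNamespace false

namespace Summit.NavierStokesRegularity.NavierStokesRegularity.Theorems.UnthreadedRigidity.SpectralEdge

open Set Function Filter Topology MeasureTheory
open scoped RealInnerProductSpace ContDiff
open Literature.Analysis.FluidPDE (sphereIntegral)
open Summit.NavierStokesRegularity.NavierStokesRegularity.Theorems.UnthreadedRigidity.ProfileHorn (E3)
open Summit.NavierStokesRegularity.NavierStokesRegularity.Theorems.UnthreadedRigidity.VirialHorn

variable {l : ℕ} {Y : E3 → ℝ}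

/-- `Δ₃(Y²) = 2|∇Y|²` for a solid harmonic. [folklore] -/
theorem lap3_sq (hY : IsSolidHarmonic l Y) (y : E3) : lap3 (fun z : E3 => Y z ^ 2) y = 2 * ‖gradient Y y‖ ^ 2 := by
  have hY2 : ContDiff ℝ 2 Y := hY.contDiff.of_le (by norm_cast)
  have hfun : (fun z : E3 => Y z ^ 2) = fun z => Y z * Y z := funext fun z => sq (Y z)
  rw [hfun]
  unfold lap3
  simp only [dir2_mul hY2 hY2]
  have hlap : ∑ i : Fin 3, dir2 Y (e i) y = 0 := hY.2 y
  have hcoord : ∀ i : Fin 3, fderiv ℝ Y y (e i) = gradient Y y i := by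
    intro i
    rw [show fderiv ℝ Y y (e i) = ⟪gradient Y y, e i⟫ from by
      rw [gradient, InnerProductSpace.toDual_symm_apply], apply_eq_inner_e]
  have hnorm : ‖gradient Y y‖ ^ 2 = ∑ i : Fin 3, gradient Y y i ^ 2 := by
    rw [EuclideanSpace.norm_sq_eq]
    simp
  simp only [Finset.sum_add_distrib, ← Finset.sum_mul, ← Finset.mul_sum, hlap, hcoord, hnorm]
  ring

/-- ★ THE BRACKET OF THE AMBIENT `Δ_S W`: `{Y, lapSW l Y} = ½Δ₃Φ − (6l² − 6l + 2)Φ` pointwise (`lapSW` unfolded). [folklore] -/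
theorem pbr_lapSW (hY : IsSolidHarmonic l Y) (y : E3) :
    pbr Y (fun y : E3 => lap3 (fun z : E3 => ‖gradient Y z‖ ^ 2) y - (2 * (l : ℝ) - 2) * (2 * (l : ℝ) - 1) * ‖gradient Y y‖ ^ 2
        - (l : ℝ) ^ 2 * (lap3 (fun z : E3 => Y z ^ 2) y - 2 * (l : ℝ) * (2 * (l : ℝ) + 1) * Y y ^ 2)) y
      = (1 / 2) * lap3 (angForm Y) y - (6 * (l : ℝ) ^ 2 - 6 * (l : ℝ) + 2) * angForm Y y := by
  -- the pieces as explicit functions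
  have hLN : lap3 (fun z : E3 => ‖gradient Y z‖ ^ 2) = fun y => 2 * ∑ i : Fin 3, ‖fderiv ℝ (gradient Y) y (e i)‖ ^ 2 :=
    funext fun y => lap3_gradSq hY y
  have hLS : lap3 (fun z : E3 => Y z ^ 2) = fun y => 2 * ‖gradient Y y‖ ^ 2 := funext fun y => lap3_sq hY y
  rw [hLN, hLS]
  beta_reduce
  -- differentiability of the pieces
  have hGn : Differentiable ℝ (fun z : E3 => ‖gradient Y z‖ ^ 2) := (hY.contDiff_gradient.differentiable (by simp)).norm_sq ℝ
  have hHs : DifferentiableAt ℝ (fun z : E3 => ∑ i : Fin 3, ‖fderiv ℝ (gradient Y) z (e i)‖ ^ 2) y := (hasFDerivAt_hessSq hY y).differentiableAt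
  have hYd : Differentiable ℝ Y := hY.contDiff.differentiable (by simp)
  have hY2 : DifferentiableAt ℝ (fun z : E3 => Y z ^ 2) y := (hYd y).pow 2
  have d1 : DifferentiableAt ℝ (fun y : E3 => 2 * ∑ i : Fin 3, ‖fderiv ℝ (gradient Y) y (e i)‖ ^ 2) y := hHs.const_mul _
  have d2 : DifferentiableAt ℝ (fun y : E3 => (2 * (l : ℝ) - 2) * (2 * (l : ℝ) - 1) * ‖gradient Y y‖ ^ 2) y := (hGn y).const_mul _
  have d3 : DifferentiableAt ℝ (fun y : E3 => 2 * ‖gradient Y y‖ ^ 2 - 2 * (l : ℝ) * (2 * (l : ℝ) + 1) * Y y ^ 2) y :=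
    ((hGn y).const_mul _).sub (hY2.const_mul _)
  have d4 : DifferentiableAt ℝ (fun y : E3 => (l : ℝ) ^ 2 * (2 * ‖gradient Y y‖ ^ 2 - 2 * (l : ℝ) * (2 * (l : ℝ) + 1) * Y y ^ 2)) y := d3.const_mul _
  have d12 : DifferentiableAt ℝ (fun y : E3 => 2 * ∑ i : Fin 3, ‖fderiv ℝ (gradient Y) y (e i)‖ ^ 2
      - (2 * (l : ℝ) - 2) * (2 * (l : ℝ) - 1) * ‖gradient Y y‖ ^ 2) y := d1.sub d2
  have d5 : DifferentiableAt ℝ (fun y : E3 => 2 * ‖gradient Y y‖ ^ 2) y := (hGn y).const_mul _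
  have d6 : DifferentiableAt ℝ (fun y : E3 => 2 * (l : ℝ) * (2 * (l : ℝ) + 1) * Y y ^ 2) y := hY2.const_mul _
  rw [pbr_sub Y d12 d4, pbr_sub Y d1 d2, pbr_const_mul Y _ hHs, pbr_const_mul Y _ (hGn y), pbr_const_mul Y _ d3,
    pbr_sub Y d5 d6, pbr_const_mul Y _ (hGn y), pbr_const_mul Y _ hY2, pbr_self_sq hY y]
  have hB := bracketLaplacian l Y hY y
  have hA : pbr Y (fun z : E3 => ‖gradient Y z‖ ^ 2) y = angForm Y y := rfl
  rw [hA]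
  linear_combination (-1 / 2 : ℝ) * hB

/-- ★ **O-INT — the sketch's `EdgeIntegralIdentity l` VERBATIM** (sketch-local `edgeForm` / `hessSq` / `gradSq` / `coerciveFunctional` / `lapSW` unfolded),
every degree: the edge pairing `∫_{S²} 48𝔅_l[Y]·Φ` equals the coercive functional `S(σ)`; the integrands agree pointwise. -/
theorem edgeIntegralIdentity (l : ℕ) :
    ∀ Y : E3 → ℝ, IsSolidHarmonic l Y →
      sphereIntegral (volume : Measure E3)
          (fun y => (lap3 (angForm Y) y - (4 * (l : ℝ) ^ 2 - 20 * (l : ℝ) + 6) * angForm Y y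
            - 2 * pbr Y (fun z => (∑ i : Fin 3, ‖fderiv ℝ (gradient Y) z (e i)‖ ^ 2)
                - 2 * ((l : ℝ) - 1) ^ 2 * ‖gradient Y z‖ ^ 2) y) * angForm Y y) 1
        = sphereIntegral (volume : Measure E3)
          (fun y => pbr Y (fun y : E3 => lap3 (fun z : E3 => ‖gradient Y z‖ ^ 2) y
              - (2 * (l : ℝ) - 2) * (2 * (l : ℝ) - 1) * ‖gradient Y y‖ ^ 2
              - (l : ℝ) ^ 2 * (lap3 (fun z : E3 => Y z ^ 2) y - 2 * (l : ℝ) * (2 * (l : ℝ) + 1) * Y y ^ 2)) y * angForm Y y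
            + 6 * ((l : ℝ) * ((l : ℝ) + 1)) * angForm Y y ^ 2) 1 := by
  intro Y hY
  congr 1
  funext y
  rw [edgeHalfLaplacian l Y hY y, pbr_lapSW hY y]
  ring

end Summit.NavierStokesRegularity.NavierStokesRegularity.Theorems.UnthreadedRigidity.SpectralEdge

end
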